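import Summits.AtomisticToContinuum.BoseEinsteinCondensation.Theorems.BECConjugateDominationPositiveMinimiserSmallTimeBounds
import HarnessLib

/-!
# Route `BECConjugateDomination`, support item `PositiveMinimiser` — small-time expansion of the
# periodic Feynman–Kac functional against the free heat operator, II: the expansion

Step of the `C³` regularity of the periodic Feynman–Kac ground state
(item stmt-AtomisticToContinuum-11787). For a measurable pair potential with bounded
periodisation `v^per ≤ C` whose real interaction `W = (∑_{i<j} v^per(xᵢ - xⱼ)).toReal` is Lipschitz,
and a continuous periodic real `Ψ₀` (bounded, uniformly continuous), UNIFORMLY in the base point: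

  `P_t Ψ₀ (X) - (e^{-tH} Ψ₀)(X) = t · W(X) Ψ₀(X) + o(t)`   (`t → 0⁺`)

(`heatOp_sub_pfkReal_expansion`; integrate the pathwise bounds of part I: first moment of the
running supremum `O(√t)`, uniform continuity + Markov for the displacement). Combined with the
eigen-relation `e^{-tH}Ψ₀ = e^{-λt}Ψ₀` this is the generator identity `(P_tΨ₀ - Ψ₀)/t → (W - λ)Ψ₀`
uniformly (`heatOp_expansion_of_eigen`). [folklore]
-/

noncomputable section

namespace Summit.AtomisticToContinuum.BoseEinsteinCondensation.Theorems.PositiveMinimiser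

open MeasureTheory ProbabilityTheory Filter Set Metric
open scoped ENNReal NNReal Topology
open Literature.MathematicalPhysics.QuantumManyBody.BoseGas
open Literature.Probability.Process (brownian runSup runSup_nonneg)

variable {N : ℕ} {v : ℝ → ℝ≥0∞} {L : ℝ} {C : ℝ≥0}

/-! ### The expansion -/

/-- **Small-time expansion of `P_t Ψ₀ - e^{-tH}Ψ₀`, uniformly in the base point.** For a measurable
pair potential with bounded periodisation `v^per ≤ C` and Lipschitz real interaction, and a
continuous periodic `Ψ₀` (`L > 0`): for every `ε > 0` there is `t₀ > 0` with
`|P_tΨ₀(X) - (e^{-tH}Ψ₀)(X) - t W(X)Ψ₀(X)| ≤ ε t` for all `t ≤ t₀` and all `X`. [folklore] -/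
theorem heatOp_sub_pfkReal_expansion (hv : Measurable v) (hL : 0 < L)
    (hC : ∀ x, periodizedPotential v L x ≤ C) {G : ℝ} (hG : 0 ≤ G)
    (hlip : ∀ Y Z : Config N, |(periodicInteraction v L Y).toReal - (periodicInteraction v L Z).toReal|
      ≤ G * ‖Y - Z‖)
    {Ψ₀ : Config N → ℝ} (hcont : Continuous Ψ₀)
    (hper : ∀ (X : Config N) (i : Fin N) (k : Fin 3),
      Ψ₀ (X + Pi.single i (EuclideanSpace.single k L)) = Ψ₀ X)
    {ε : ℝ} (hε : 0 < ε) :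
    ∃ t₀ : ℝ, 0 < t₀ ∧ ∀ t : ℝ≥0, (t : ℝ) ≤ t₀ → ∀ X : Config N,
      |heatOp t Ψ₀ X - pfkReal v L t Ψ₀ X - t * ((periodicInteraction v L X).toReal * Ψ₀ X)| ≤ ε * t := by
  obtain ⟨M, hM0, hM⟩ := exists_bound_of_continuous_periodic hL hcont hper
  set CV : ℝ := ((N * N : ℕ) : ℝ) * C with hCV
  have hCV0 : 0 ≤ CV := by positivity
  set m : ℝ := Real.sqrt 2 * ((3 * N : ℕ) * 2) with hm
  have hm0 : 0 ≤ m := by positivity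
  -- uniform continuity scale
  have hη : 0 < ε / (4 * (CV + 1)) := by positivity
  obtain ⟨δ, hδ, hUC⟩ := periodic_uniformContinuous hL hcont hper hη
  -- the four smallness constants
  set K₁ : ℝ := M * CV ^ 2 + 1 with hK₁
  set K₂ : ℝ := M * G * m + 1 with hK₂
  set K₃ : ℝ := CV * (2 * M) * m / δ + 1 with hK₃
  have hK₁0 : 0 < K₁ := by positivity
  have hK₂0 : 0 < K₂ := by positivity
  have hK₃0 : 0 < K₃ := by positivity
  set t₀r : ℝ := min (min (1 / (CV + 1)) (ε / (4 * K₁))) (min ((ε / (4 * K₂)) ^ 2) ((ε / (4 * K₃)) ^ 2))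
    with ht₀r
  have ht₀pos : 0 < t₀r := by positivity
  refine ⟨t₀r, ht₀pos, fun t ht' X => ?_⟩
  have ht0 : (0 : ℝ) ≤ t := t.coe_nonneg
  have h_a : (t : ℝ) ≤ 1 / (CV + 1) := ht'.trans ((min_le_left _ _).trans (min_le_left _ _))
  have h_b : (t : ℝ) ≤ ε / (4 * K₁) := ht'.trans ((min_le_left _ _).trans (min_le_right _ _))
  have h_c : (t : ℝ) ≤ (ε / (4 * K₂)) ^ 2 := ht'.trans ((min_le_right _ _).trans (min_le_left _ _))
  have h_d : (t : ℝ) ≤ (ε / (4 * K₃)) ^ 2 := ht'.trans ((min_le_right _ _).trans (min_le_right _ _))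
  have hsqrt_c : Real.sqrt t ≤ ε / (4 * K₂) :=
    (Real.sqrt_le_sqrt h_c).trans (le_of_eq (Real.sqrt_sq (by positivity)))
  have hsqrt_d : Real.sqrt t ≤ ε / (4 * K₃) :=
    (Real.sqrt_le_sqrt h_d).trans (le_of_eq (Real.sqrt_sq (by positivity)))
  have hsmall : CV * t ≤ 1 := by
    calc CV * t ≤ CV * (1 / (CV + 1)) := mul_le_mul_of_nonneg_left h_a hCV0
      _ ≤ 1 := by rw [mul_one_div, div_le_one (by positivity)]; linarith
  -- notation
  set W : Config N → ℝ := fun Y => (periodicInteraction v L Y).toReal with hW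
  set η : ℝ := ε / (4 * (CV + 1)) with hηdef
  set S : Set (PathSpace N) := {ω | δ ≤ ‖displacement t ω‖} with hS
  have hSm : MeasurableSet S := measurableSet_le measurable_const (measurable_displacement t).norm
  set R : PathSpace N → ℝ := fun ω => Real.sqrt 2 * ∑ i, ∑ k, runSup t (ω i k) with hR
  -- the integrand and its bound
  set F : PathSpace N → ℝ := fun ω => Ψ₀ (X + displacement t ω) -
      (periodicFKWeight v L t X ω).toReal * Ψ₀ (X + displacement t ω) - t * (W X * Ψ₀ X) with hF
  set g : PathSpace N → ℝ := fun ω => M * (CV * t) ^ 2 + t * (M * (G * R ω)) +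
      t * CV * (η + 2 * M * S.indicator (fun _ => (1 : ℝ)) ω) with hg
  have hFg : ∀ ω, ‖F ω‖ ≤ g ω := by
    intro ω
    rw [Real.norm_eq_abs]
    have h1 := abs_smallTime_integrand_le hC hG hlip hM (t := t) hsmall X ω
    have h2 := abs_sub_le_eta_add_indicator hM hη.le hUC X (displacement t ω)
    have hind : Set.indicator {h' : Config N | δ ≤ ‖h'‖} (fun _ => (1 : ℝ)) (displacement t ω) =
        S.indicator (fun _ => (1 : ℝ)) ω := by
      by_cases hω : δ ≤ ‖displacement t ω‖
      · rw [Set.indicator_of_mem (show displacement t ω ∈ {h' : Config N | δ ≤ ‖h'‖} from hω),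
          Set.indicator_of_mem (show ω ∈ S from hω)]
      · rw [Set.indicator_of_notMem (show displacement t ω ∉ {h' : Config N | δ ≤ ‖h'‖} from hω),
          Set.indicator_of_notMem (show ω ∉ S from hω)]
    rw [hind] at h2
    refine h1.trans ?_
    simp only [hg]
    refine add_le_add le_rfl ?_
    exact mul_le_mul_of_nonneg_left h2 (mul_nonneg ht0 hCV0)
  -- integrability
  have hΨm : Measurable Ψ₀ := hcont.measurable
  have hint1 : Integrable (fun ω => Ψ₀ (X + displacement t ω)) (wienerPaths N) :=
    integrable_comp_add_displacement (E := ℝ) hcont (fun Y => by rw [Real.norm_eq_abs]; exact hM Y) X t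
  have hint2 : Integrable (fun ω => (periodicFKWeight v L t X ω).toReal * Ψ₀ (X + displacement t ω))
      (wienerPaths N) := by
    refine Integrable.mono' (integrable_const M)
      (((measurable_periodicFKWeight hv L t X).ennreal_toReal.mul
        (hΨm.comp (measurable_add_displacement X t))).aestronglyMeasurable)
      (Eventually.of_forall fun ω => ?_)
    rw [Real.norm_eq_abs, abs_mul, abs_of_nonneg (toReal_periodicFKWeight_nonneg v L t X ω)]
    calc (periodicFKWeight v L t X ω).toReal * |Ψ₀ (X + displacement t ω)| ≤ 1 * M :=
          mul_le_mul (toReal_periodicFKWeight_le_one v L t X ω) (hM _) (abs_nonneg _) zero_le_one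
      _ = M := one_mul M
  have hRi : Integrable R (wienerPaths N) := (integrable_sum_runSup t).const_mul (Real.sqrt 2)
  have hSi : Integrable (S.indicator fun _ => (1 : ℝ)) (wienerPaths N) := (integrable_const (1 : ℝ)).indicator hSm
  have hg2i : Integrable (fun ω => (t : ℝ) * (M * (G * R ω))) (wienerPaths N) :=
    ((hRi.const_mul G).const_mul M).const_mul (t : ℝ)
  have hg3i : Integrable (fun ω => (t : ℝ) * CV * (η + 2 * M * S.indicator (fun _ => (1 : ℝ)) ω)) (wienerPaths N) :=
    ((integrable_const η).add (hSi.const_mul (2 * M))).const_mul ((t : ℝ) * CV)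
  have hg12i : Integrable (fun ω => M * (CV * t) ^ 2 + (t : ℝ) * (M * (G * R ω))) (wienerPaths N) :=
    (integrable_const _).add hg2i
  have hgint : Integrable g (wienerPaths N) := hg12i.add hg3i
  -- the identity
  have hint12 : Integrable (fun ω => Ψ₀ (X + displacement t ω) -
      (periodicFKWeight v L t X ω).toReal * Ψ₀ (X + displacement t ω)) (wienerPaths N) := hint1.sub hint2
  have hI : ∫ ω, F ω ∂wienerPaths N = heatOp t Ψ₀ X - pfkReal v L t Ψ₀ X - t * (W X * Ψ₀ X) := by
    have e1 : pfkReal v L t Ψ₀ X =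
        ∫ ω, (periodicFKWeight v L t X ω).toReal * Ψ₀ (X + displacement t ω) ∂wienerPaths N := by
      simp only [pfkReal, Real.toNNReal_coe, worldLine_eq_add_displacement]
    simp only [hF]
    rw [integral_sub hint12 (integrable_const _), integral_sub hint1 hint2, integral_const, e1, heatOp]
    simp
  -- integrate the bound
  have hbound : |heatOp t Ψ₀ X - pfkReal v L t Ψ₀ X - t * (W X * Ψ₀ X)| ≤ ∫ ω, g ω ∂wienerPaths N := by
    rw [← hI, ← Real.norm_eq_abs]
    exact norm_integral_le_of_norm_le hgint (Eventually.of_forall hFg)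
  -- evaluate the integral of the bound
  have hRint : ∫ ω, R ω ∂wienerPaths N ≤ m * Real.sqrt t := by
    simp only [hR]
    rw [integral_const_mul]
    calc Real.sqrt 2 * ∫ ω, ∑ i, ∑ k, runSup t (ω i k) ∂wienerPaths N
        ≤ Real.sqrt 2 * ((3 * N : ℕ) * (2 * Real.sqrt t)) :=
          mul_le_mul_of_nonneg_left (integral_sum_runSup_le t) (Real.sqrt_nonneg _)
      _ = m * Real.sqrt t := by simp only [hm]; ring
  have hPS : (wienerPaths N).real S ≤ m * Real.sqrt t / δ := by
    have h := measure_norm_displacement_ge_le_periodic (N := N) (le_refl t) hδ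
    have h' : wienerPaths N S ≤ ENNReal.ofReal (m * Real.sqrt t / δ) := by
      refine h.trans (le_of_eq ?_)
      congr 1
      simp only [hm]; ring
    exact ENNReal.toReal_le_of_le_ofReal (by positivity) h'
  have hI2 : ∫ ω, (t : ℝ) * (M * (G * R ω)) ∂wienerPaths N = t * (M * (G * ∫ ω, R ω ∂wienerPaths N)) := by
    rw [integral_const_mul, integral_const_mul, integral_const_mul]
  have hI3 : ∫ ω, (t : ℝ) * CV * (η + 2 * M * S.indicator (fun _ => (1 : ℝ)) ω) ∂wienerPaths N =
      t * CV * (η + 2 * M * (wienerPaths N).real S) := by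
    rw [integral_const_mul, integral_add (integrable_const η) (hSi.const_mul (2 * M)), integral_const,
      integral_const_mul, integral_indicator_const _ hSm]
    simp
  have hgval : ∫ ω, g ω ∂wienerPaths N =
      M * (CV * t) ^ 2 + t * (M * (G * ∫ ω, R ω ∂wienerPaths N)) +
        t * CV * (η + 2 * M * (wienerPaths N).real S) := by
    simp only [hg]
    rw [integral_add hg12i hg3i, integral_add (integrable_const _) hg2i, integral_const, hI2, hI3]
    simp
  -- the four estimates
  have q1 : M * (CV * t) ^ 2 ≤ ε / 4 * t := by
    have hle : M * CV ^ 2 ≤ K₁ := by simp only [hK₁]; linarith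
    calc M * (CV * t) ^ 2 = (M * CV ^ 2 * t) * t := by ring
      _ ≤ (K₁ * (ε / (4 * K₁))) * t := by
          refine mul_le_mul_of_nonneg_right ?_ ht0
          exact (mul_le_mul_of_nonneg_right hle ht0).trans (mul_le_mul_of_nonneg_left h_b hK₁0.le)
      _ = ε / 4 * t := by field_simp
  have q2 : M * (G * ∫ ω, R ω ∂wienerPaths N) ≤ ε / 4 := by
    calc M * (G * ∫ ω, R ω ∂wienerPaths N) ≤ M * (G * (m * Real.sqrt t)) :=
          mul_le_mul_of_nonneg_left (mul_le_mul_of_nonneg_left hRint hG) hM0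
      _ = M * G * m * Real.sqrt t := by ring
      _ ≤ K₂ * Real.sqrt t := mul_le_mul_of_nonneg_right (by linarith) (Real.sqrt_nonneg _)
      _ ≤ K₂ * (ε / (4 * K₂)) := mul_le_mul_of_nonneg_left hsqrt_c hK₂0.le
      _ = ε / 4 := by field_simp
  have q3 : CV * η ≤ ε / 4 := by
    have hfrac : CV / (CV + 1) ≤ 1 := (div_le_one (by positivity)).2 (by linarith)
    calc CV * η = CV / (CV + 1) * (ε / 4) := by simp only [hηdef]; field_simp
      _ ≤ 1 * (ε / 4) := mul_le_mul_of_nonneg_right hfrac (by positivity)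
      _ = ε / 4 := one_mul _
  have q4 : CV * (2 * M * (wienerPaths N).real S) ≤ ε / 4 := by
    calc CV * (2 * M * (wienerPaths N).real S) ≤ CV * (2 * M * (m * Real.sqrt t / δ)) :=
          mul_le_mul_of_nonneg_left (mul_le_mul_of_nonneg_left hPS (by positivity)) hCV0
      _ = (CV * (2 * M) * m / δ) * Real.sqrt t := by ring
      _ ≤ K₃ * Real.sqrt t := mul_le_mul_of_nonneg_right (by linarith) (Real.sqrt_nonneg _)
      _ ≤ K₃ * (ε / (4 * K₃)) := mul_le_mul_of_nonneg_left hsqrt_d hK₃0.le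
      _ = ε / 4 := by field_simp
  calc |heatOp t Ψ₀ X - pfkReal v L t Ψ₀ X - t * (W X * Ψ₀ X)| ≤ ∫ ω, g ω ∂wienerPaths N := hbound
    _ = M * (CV * t) ^ 2 + t * (M * (G * ∫ ω, R ω ∂wienerPaths N)) +
        t * CV * (η + 2 * M * (wienerPaths N).real S) := hgval
    _ ≤ ε / 4 * t + t * (ε / 4) + t * (ε / 4 + ε / 4) := by
        refine add_le_add (add_le_add q1 (mul_le_mul_of_nonneg_left q2 ht0)) ?_
        rw [mul_assoc]
        refine mul_le_mul_of_nonneg_left ?_ ht0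
        calc CV * (η + 2 * M * (wienerPaths N).real S) = CV * η + CV * (2 * M * (wienerPaths N).real S) := by ring
          _ ≤ ε / 4 + ε / 4 := add_le_add q3 q4
    _ = ε * t := by ring

/-- **The generator expansion from the eigen-relation**: if moreover `e^{-tH}Ψ₀ = e^{-λt}Ψ₀`
pointwise for `t > 0`, then `|P_tΨ₀(X) - Ψ₀(X) - t (W(X) - λ)Ψ₀(X)| ≤ ε t` for `t ≤ t₀`, all `X`
(`(P_tΨ₀ - Ψ₀)/t → (W - λ)Ψ₀` uniformly: `Ψ₀` lies in the domain of the generator of the free flow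
on periodic continuous functions). [folklore] -/
theorem heatOp_expansion_of_eigen (hv : Measurable v) (hL : 0 < L)
    (hC : ∀ x, periodizedPotential v L x ≤ C) {G : ℝ} (hG : 0 ≤ G)
    (hlip : ∀ Y Z : Config N, |(periodicInteraction v L Y).toReal - (periodicInteraction v L Z).toReal|
      ≤ G * ‖Y - Z‖)
    {Ψ₀ : Config N → ℝ} (hcont : Continuous Ψ₀)
    (hper : ∀ (X : Config N) (i : Fin N) (k : Fin 3),
      Ψ₀ (X + Pi.single i (EuclideanSpace.single k L)) = Ψ₀ X)
    {lam : ℝ} (heig : ∀ t : ℝ, 0 < t → ∀ X, pfkReal v L t Ψ₀ X = Real.exp (-(lam * t)) * Ψ₀ X)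
    {ε : ℝ} (hε : 0 < ε) :
    ∃ t₀ : ℝ, 0 < t₀ ∧ ∀ t : ℝ≥0, (t : ℝ) ≤ t₀ → ∀ X : Config N,
      |heatOp t Ψ₀ X - Ψ₀ X - t * (((periodicInteraction v L X).toReal - lam) * Ψ₀ X)| ≤ ε * t := by
  obtain ⟨M, hM0, hM⟩ := exists_bound_of_continuous_periodic hL hcont hper
  obtain ⟨t₁, ht₁, h₁⟩ := heatOp_sub_pfkReal_expansion hv hL hC hG hlip hcont hper (half_pos hε)
  -- smallness for the exponential term: `|λ| t ≤ 1` and `M λ² t ≤ ε/2`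
  set K : ℝ := M * lam ^ 2 + |lam| + 1 with hK
  have hK0 : 0 < K := by positivity
  have hKge : |lam| ≤ K := by
    have := mul_nonneg hM0 (sq_nonneg lam); simp only [hK]; linarith
  have hKge' : M * lam ^ 2 ≤ K := by simp only [hK]; linarith [abs_nonneg lam]
  set t₂r : ℝ := min (1 / K) (ε / (2 * K)) with ht₂r
  have ht₂pos : 0 < t₂r := by positivity
  refine ⟨min t₁ t₂r, lt_min ht₁ ht₂pos, fun t ht X => ?_⟩
  have ht1 : (t : ℝ) ≤ t₁ := ht.trans (min_le_left _ _)
  have ht2 : (t : ℝ) ≤ t₂r := ht.trans (min_le_right _ _)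
  have ht0 : (0 : ℝ) ≤ t := t.coe_nonneg
  have hA := h₁ t ht1 X
  -- the eigen-relation at time `t` (also valid at `t = 0`)
  have heig' : pfkReal v L t Ψ₀ X = Real.exp (-(lam * t)) * Ψ₀ X := by
    rcases eq_or_lt_of_le ht0 with h | h
    · rw [← h]
      simp [pfkReal_of_nonpos v L le_rfl]
    · exact heig t h X
  -- `|e^{-λt} - 1 + λt| ≤ (λt)²`
  have hlt : |lam| * t ≤ 1 := by
    calc |lam| * t ≤ K * t := mul_le_mul_of_nonneg_right hKge ht0
      _ ≤ K * (1 / K) := mul_le_mul_of_nonneg_left (ht2.trans (min_le_left _ _)) hK0.le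
      _ = 1 := by field_simp
  have hexp : |Real.exp (-(lam * t)) - 1 + lam * t| ≤ (lam * t) ^ 2 := by
    have h := Real.abs_exp_sub_one_sub_id_le (x := -(lam * t))
      (by rw [abs_neg, abs_mul, abs_of_nonneg ht0]; exact hlt)
    rw [neg_sq] at h
    simpa [sub_neg_eq_add] using h
  have hB : |(Real.exp (-(lam * t)) - 1 + lam * t) * Ψ₀ X| ≤ ε / 2 * t := by
    rw [abs_mul]
    calc |Real.exp (-(lam * t)) - 1 + lam * t| * |Ψ₀ X| ≤ (lam * t) ^ 2 * M :=
          mul_le_mul hexp (hM X) (abs_nonneg _) (sq_nonneg _)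
      _ = (M * lam ^ 2 * t) * t := by ring
      _ ≤ (K * t) * t := mul_le_mul_of_nonneg_right (mul_le_mul_of_nonneg_right hKge' ht0) ht0
      _ ≤ (K * (ε / (2 * K))) * t :=
          mul_le_mul_of_nonneg_right (mul_le_mul_of_nonneg_left (ht2.trans (min_le_right _ _)) hK0.le) ht0
      _ = ε / 2 * t := by field_simp
  have hsplit : heatOp t Ψ₀ X - Ψ₀ X - t * (((periodicInteraction v L X).toReal - lam) * Ψ₀ X) =
      (heatOp t Ψ₀ X - pfkReal v L t Ψ₀ X - t * ((periodicInteraction v L X).toReal * Ψ₀ X)) +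
        (Real.exp (-(lam * t)) - 1 + lam * t) * Ψ₀ X := by
    rw [heig']; ring
  rw [hsplit]
  calc |heatOp t Ψ₀ X - pfkReal v L t Ψ₀ X - t * ((periodicInteraction v L X).toReal * Ψ₀ X) +
        (Real.exp (-(lam * t)) - 1 + lam * t) * Ψ₀ X|
      ≤ |heatOp t Ψ₀ X - pfkReal v L t Ψ₀ X - t * ((periodicInteraction v L X).toReal * Ψ₀ X)| +
        |(Real.exp (-(lam * t)) - 1 + lam * t) * Ψ₀ X| := abs_add_le _ _
    _ ≤ ε / 2 * t + ε / 2 * t := add_le_add hA hB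
    _ = ε * t := by ring

end Summit.AtomisticToContinuum.BoseEinsteinCondensation.Theorems.PositiveMinimiser

end
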